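import Summits.Ventures.HSemireg.WedgeHankelDivisorRank
import Summits.Ventures.HSemireg.WedgeHankelConfluentRank
import Summits.Ventures.HSemireg.WedgeHankelSecantKernel

/-!
# Venture HSemireg — THE DIVISOR KERNEL LAW: the class `Σ_i exp(λ_i Θ)·p_i(Θ)` with divisor `Σ_i (P_i + 1)[λ_i]` has kernel
# `⋂_i (SI_k ⊔ Φs λ_i (xRich(k, P_i)))` — the forms killing it are EXACTLY the forms killing each of its nodes (total order ≤ min(k+1, n+1−k))

HONEST FRAMING. Part of the Lean index of the computation cell `pub-hsemireg` (seat p10 gen 16, Sunday typer «UNIFORM-IN-n»).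
Finite-dimensional EXTERIOR ALGEBRA over a field ONLY: no variety, no cohomology theory, no sheaf, no Ext group, no semiregularity map;
nothing here says that HC / HC_CM / HC_AV holds; no Literature fact is declared or used.  Custodian versions as in `WedgeHankelSiegelIdeal` (1/3) and
`WedgeHankelFrameChange`; the dictionary (`exp(λΘ)·p(Θ)` ↦ `expMul λ q`; the divisor of a class) is QUOTED, never asserted.

WHAT IS IN THE TREE.  E5 `Kr_w_expMul_of_order`: ONE node `λ` of order `P + 1` has kernel `SI_k ⊔ Φs λ (xRich(k, P))` (`k + P ≤ n`), of codimension
`(P + 1)·C(n,k)` (E6); D2 `Kr_w_secSeq`: `r` SIMPLE nodes have kernel the intersection of their frame ideals, by CODIMENSION (`finrank_le_finrank_inf_inf_add`)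
against D1's secant rank; F2a `rank_hankel1_expMul_sum`: the Hankel rank of a divisor class is its total order `D = Σ_i (P_i + 1)` (`D ≤ k + 1`, `D ≤ n + 1 − k`).
THIS FILE runs D2's codimension argument with multiplicities:
* §53 `iInf_Kr_w_le_Kr_w_sum`: a form killing every summand kills the sum (any family of coefficient sequences).
* §54 **THE DIVISOR KERNEL LAW `Kr_w_expMul_sum`**: distinct `λ_i` (`r ≥ 1`), `q_i` supported on `[0, P_i]` with `q_i(P_i) ≠ 0`, `D = Σ_i (P_i+1) ≤ k + 1` and
  `D ≤ n + 1 − k` ⇒ **`Kr(univ, w_n(Σ_i expMul λ_i q_i), k) = ⋂_i (SI_k ⊔ Φs λ_i (xRich(k, P_i)))`**, with the kernel number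
  `dim Kr + D·C(n,k) = C(2n,k)` (`finrank_Kr_w_expMul_sum_add`); it depends only on the divisor (`Kr_w_expMul_sum_eq`); all `P_i = 0`: the intersection of the
  `r` images `Φs λ_i (xRich(k,0))` — D2's frame ideals `F_{λ_i}(k)` by value (`Kr_w_expMul_sum_simple`).
NOT typed here: `D ≥ k + 1` (generic kernel `SI_k`; needs the full-row-rank regime of F2a); a node at `∞` among the `λ_i` (transport by E7's swap would need the
rank law for `rev_n` of a divisor class — F1's Bruhat identity does it for one extra node); degrees `2k > n` beyond `D ≤ n + 1 − k` (mirror: E1's duality).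
Class side only.  Namespace `Summit.Ventures.HSemireg.Wedge.HankelFrameChange` (continued); new names only.
-/

open Module

namespace Summit.Ventures.HSemireg.Wedge.HankelFrameChange

open Summit.Ventures.HSemireg.Wedge Summit.Ventures.HSemireg.Wedge.Kunneth Summit.Ventures.HSemireg.Wedge.Hankel
  Summit.Ventures.HSemireg.Wedge.HankelSiegel Summit.Ventures.HSemireg.Wedge.HankelSiegelIdeal Summit.Ventures.HSemireg.Wedge.KunnethKernel
  Summit.Ventures.HSemireg.Wedge.HankelSecant

variable (K : Type*) [Field K] {n : ℕ}

/-! ## §53. A form killing every summand kills the sum -/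

/-- th-7's class of a finite sum of coefficient sequences is the sum of the classes. -/
lemma w_finsum {ι : Type*} (s : Finset ι) (q : ι → ℕ → K) (m : ℕ) : w K n m (fun j => ∑ i ∈ s, q i j) = ∑ i ∈ s, w K n m (q i) := by
  have e : (fun j => ∑ i ∈ s, q i j) = fun j => ∑ i ∈ s, (1 : K) * q i j := by funext j; simp
  rw [e, w_sum_smul]; simp

/-- **`⋂_i Kr(univ, w_n(q_i), k) ≤ Kr(univ, w_n(Σ_i q_i), k)`** for every finite family (`r ≥ 1`). -/
theorem iInf_Kr_w_le_Kr_w_sum {r : ℕ} (hr : 0 < r) (q : Fin r → ℕ → K) (k : ℕ) :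
    (⨅ i, Kr K Finset.univ (w K n n (q i)) k) ≤ Kr K Finset.univ (w K n n (fun j => ∑ i, q i j)) k := by
  intro θ hθ
  rw [Submodule.mem_iInf] at hθ
  refine mem_Kr.mpr ⟨(mem_Kr.mp (hθ ⟨0, hr⟩)).1, ?_⟩
  rw [w_finsum, Finset.mul_sum]
  exact Finset.sum_eq_zero fun i _ => (mem_Kr.mp (hθ i)).2

/-! ## §54. The divisor kernel law -/

/-- `dim Hom(univ, k) = C(2n, k)` (private copy). -/
private lemma finrank_Hom_univ_fc (k : ℕ) : finrank K (Hom K (In n) Finset.univ k) = (n + n).choose k := by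
  rw [Hom_univ_eq_exteriorPower, exteriorPower.finrank_eq, finrank_fintype_fun_eq_card, Fintype.card_fin]

/-- the kernel number of ONE node `λ` of order `P + 1`: `dim Kr(univ, w_n(expMul λ q), k) + (P + 1)·C(n,k) = C(2n,k)` for `P ≤ k`, `k + P ≤ n` (E5/E6). -/
theorem finrank_Kr_w_expMul_of_order_add (lam : K) {k P : ℕ} (hPk : P ≤ k) (hkP : k + P ≤ n) {q : ℕ → K} (hq : ∀ j, P < j → q j = 0)
    (hqP : q P ≠ 0) : finrank K (Kr K Finset.univ (w K n n (expMul K lam q)) k) + (P + 1) * n.choose k = (n + n).choose k := by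
  have h := finrank_Kr_w_of_order K hkP hq hqP
  rw [min_eq_left hPk] at h
  rw [finrank_Kr_w_expMul, h]

/-- **THE KERNEL NUMBER OF A DIVISOR CLASS: `dim Kr(univ, w_n(Σ_i expMul λ_i q_i), k) + D·C(n,k) = C(2n,k)`**, `D = Σ_i (P_i+1) ≤ min(k+1, n+1−k)`
(F2a's rank law + THEOREM H). -/
theorem finrank_Kr_w_expMul_sum_add {k r : ℕ} {lam : Fin r → K} (hlam : Function.Injective lam) {P : Fin r → ℕ} {q : Fin r → ℕ → K}
    (hq : ∀ i j, P i < j → q i j = 0) (hqP : ∀ i, q i (P i) ≠ 0) (hDk : ∑ i, (P i + 1) ≤ k + 1) (hDn : ∑ i, (P i + 1) ≤ n + 1 - k) :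
    finrank K (Kr K Finset.univ (w K n n (fun j => ∑ i, expMul K (lam i) (q i) j)) k) + (∑ i, (P i + 1)) * n.choose k = (n + n).choose k := by
  have h := finrank_Kr_w_add_rank K (n := n) k (fun j => ∑ i, expMul K (lam i) (q i) j)
  rw [rank_hankel1_expMul_sum K hlam hq hqP hDk hDn, Nat.mul_comm] at h
  exact h

/-- codimension subadditivity for the node kernels: `C(2n,k) ≤ dim ⋂_i Kr(node i) + D·C(n,k)`. -/
theorem iInf_Kr_w_expMul_ge {k r : ℕ} (hr : 0 < r) (lam : Fin r → K) {P : Fin r → ℕ} {q : Fin r → ℕ → K}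
    (hq : ∀ i j, P i < j → q i j = 0) (hqP : ∀ i, q i (P i) ≠ 0) (hDk : ∑ i, (P i + 1) ≤ k + 1) (hDn : ∑ i, (P i + 1) ≤ n + 1 - k) :
    (n + n).choose k ≤ finrank K ↥(⨅ i, Kr K Finset.univ (w K n n (expMul K (lam i) (q i))) k) + (∑ i, (P i + 1)) * n.choose k := by
  have hPi : ∀ i, P i + 1 ≤ ∑ j, (P j + 1) := fun i => Finset.single_le_sum (fun j _ => Nat.zero_le (P j + 1)) (Finset.mem_univ i)
  have h := finrank_le_finrank_inf_inf_add K Finset.univ (Hom K (In n) Finset.univ k)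
    (fun i => Kr K Finset.univ (w K n n (expMul K (lam i) (q i))) k) (fun i _ => Kr_le_Hom K _ _ _)
  have hinf : (Hom K (In n) Finset.univ k ⊓ Finset.univ.inf fun i => Kr K Finset.univ (w K n n (expMul K (lam i) (q i))) k) =
      ⨅ i, Kr K Finset.univ (w K n n (expMul K (lam i) (q i))) k := by
    rw [Finset.inf_univ_eq_iInf]
    exact inf_eq_right.mpr ((iInf_le _ ⟨0, hr⟩).trans (Kr_le_Hom K _ _ _))
  rw [hinf, finrank_Hom_univ_fc] at h
  have hcod : ∀ i, (n + n).choose k - finrank K (Kr K Finset.univ (w K n n (expMul K (lam i) (q i))) k) = (P i + 1) * n.choose k := by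
    intro i
    have := finrank_Kr_w_expMul_of_order_add K (n := n) (lam i) (k := k) (P := P i) (by have := hPi i; omega) (by have := hPi i; omega) (hq i) (hqP i)
    omega
  simp only [hcod] at h
  rwa [← Finset.sum_mul] at h

/-- **THE DIVISOR KERNEL LAW.**  Distinct nodes `λ_0, …, λ_{r−1}` (`r ≥ 1`), coefficient sequences `q_i` supported on `[0, P_i]` with `q_i(P_i) ≠ 0`, total
order `D = Σ_i (P_i + 1) ≤ k + 1` and `D ≤ n + 1 − k`:
**`Kr(univ, w_n(Σ_i expMul λ_i q_i), k) = ⋂_i (SI_k ⊔ Φs λ_i (xRich(k, P_i)))`** — the forms killing the class `Σ_i exp(λ_i Θ)·p_i(Θ)` are EXACTLY the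
forms killing each of its nodes with multiplicity: the Siegel ideal plus more than `P_i` letters from the frame `{x_a + λ_i y_a}`, for every `i`. -/
theorem Kr_w_expMul_sum {k r : ℕ} (hr : 0 < r) {lam : Fin r → K} (hlam : Function.Injective lam) {P : Fin r → ℕ} {q : Fin r → ℕ → K}
    (hq : ∀ i j, P i < j → q i j = 0) (hqP : ∀ i, q i (P i) ≠ 0) (hDk : ∑ i, (P i + 1) ≤ k + 1) (hDn : ∑ i, (P i + 1) ≤ n + 1 - k) :
    Kr K Finset.univ (w K n n (fun j => ∑ i, expMul K (lam i) (q i) j)) k =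
      ⨅ i, (siegelIdeal K n k ⊔ (xRich K n k (P i)).map (Φs K (n := n) (lam i)).toLinearMap) := by
  have hPi : ∀ i, P i + 1 ≤ ∑ j, (P j + 1) := fun i => Finset.single_le_sum (fun j _ => Nat.zero_le (P j + 1)) (Finset.mem_univ i)
  have e : (⨅ i, (siegelIdeal K n k ⊔ (xRich K n k (P i)).map (Φs K (n := n) (lam i)).toLinearMap)) =
      ⨅ i, Kr K Finset.univ (w K n n (expMul K (lam i) (q i))) k :=
    iInf_congr fun i => (Kr_w_expMul_of_order K (lam i) (by have := hPi i; omega) (hq i) (hqP i)).symm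
  rw [e]
  refine (Submodule.eq_of_le_of_finrank_le (iInf_Kr_w_le_Kr_w_sum K hr _ k) ?_).symm
  have h1 := finrank_Kr_w_expMul_sum_add K hlam hq hqP hDk hDn
  have h2 := iInf_Kr_w_expMul_ge K hr lam hq hqP hDk hDn
  omega

/-- **THE KERNEL DEPENDS ONLY ON THE DIVISOR** `Σ_i (P_i + 1)[λ_i]` (not on the coefficients `q_i`). -/
theorem Kr_w_expMul_sum_eq {k r : ℕ} (hr : 0 < r) {lam : Fin r → K} (hlam : Function.Injective lam) {P : Fin r → ℕ} {q q' : Fin r → ℕ → K}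
    (hq : ∀ i j, P i < j → q i j = 0) (hqP : ∀ i, q i (P i) ≠ 0) (hq' : ∀ i j, P i < j → q' i j = 0) (hqP' : ∀ i, q' i (P i) ≠ 0)
    (hDk : ∑ i, (P i + 1) ≤ k + 1) (hDn : ∑ i, (P i + 1) ≤ n + 1 - k) :
    Kr K Finset.univ (w K n n (fun j => ∑ i, expMul K (lam i) (q i) j)) k = Kr K Finset.univ (w K n n (fun j => ∑ i, expMul K (lam i) (q' i) j)) k := by
  rw [Kr_w_expMul_sum K hr hlam hq hqP hDk hDn, Kr_w_expMul_sum K hr hlam hq' hqP' hDk hDn]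

/-- **ALL NODES SIMPLE** (`P_i = 0`): `Kr(univ, w_n(Σ_i A_i λ_i^•), k) = ⋂_i Φs λ_i (xRich(k, 0))` for distinct `λ_i`, `A_i ≠ 0`, `1 ≤ r ≤ k + 1`, `r ≤ n + 1 − k`
— D2's secant kernel law (the intersection of the frame ideals `F_{λ_i}(k)`) in E5's vocabulary. -/
theorem Kr_w_expMul_sum_simple {k r : ℕ} (hr : 0 < r) {lam : Fin r → K} (hlam : Function.Injective lam) {A : Fin r → K} (hA : ∀ i, A i ≠ 0)
    (hrk : r ≤ k + 1) (hrn : r ≤ n + 1 - k) :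
    Kr K Finset.univ (w K n n (fun j => ∑ i, A i * lam i ^ j)) k = ⨅ i, (xRich K n k 0).map (Φs K (n := n) (lam i)).toLinearMap := by
  have e : (fun j => ∑ i, A i * lam i ^ j) = fun j => ∑ i, expMul K (lam i) (fun t => if t = 0 then A i else 0) j := by
    funext j; exact Finset.sum_congr rfl fun i _ => (expMul_spike_zero K (lam i) (A i) j).symm
  have hD : ∑ i : Fin r, ((fun _ => 0 : Fin r → ℕ) i + 1) = r := by simp
  rw [e, Kr_w_expMul_sum K hr hlam (P := fun _ => 0) (fun i j hj => if_neg (by omega)) (fun i => by rw [if_pos rfl]; exact hA i)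
      (by rw [hD]; exact hrk) (by rw [hD]; exact hrn)]
  refine iInf_congr fun i => sup_eq_right.mpr ?_
  calc siegelIdeal K n k = (siegelIdeal K n k).map (Φs K (n := n) (lam i)).toLinearMap := (map_Φs_siegelIdeal K (lam i) k).symm
    _ ≤ (xRich K n k 0).map (Φs K (n := n) (lam i)).toLinearMap := Submodule.map_mono (siegelIdeal_le_xRich_zero K k)

end Summit.Ventures.HSemireg.Wedge.HankelFrameChange
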